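import Summits.ABC.ABC.Theorems.CongruentialReceptacleTameLocalReceptacleCellLawsDefs
import Summits.ABC.ABC.Theorems.CongruentialReceptacleTameLocalReceptacleFamiliesDefs

/-!
# Crux `CongruentialReceptacle.TameLocalReceptacle` (stmt-ABC-14354), line `grh-friable-cell-resolution`:
# the engine's FAMILY-LEVEL targets (skeleton v6)

Lead `prover-line-stmt-ABC-14354-a1-0`, 2026-08-17.  The analytic engine of the line is re-sited (lead's NOTES `## Engine v3`):
constant 2-adic depth `N`, explicit witnesses `FA = FAfam N M y`, `FB`, `FC`, `G = FAfam 1 (2^{N-1} M) y`, `G' = FAfam 1 M y` at the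
master scale `x = 48 · 2^N · M` with `y = ⌊(log x)^K⌋`, `K = 10⁵`, one saddle line `α(x, y)` for every variable, and a
MODEL-FREE interface to `KeyCellStructure (1/4)`:

* `CECells` — class equidistribution INSIDE every shallow key cell, with an absolute polylog-small error (mechanism: the exact
  class-uniformity identity `Literature…SmoothArcs.sum_coprime_classWeightedSum_mul_eq`; only non-principal (GRH) and minor-arc
  errors remain);
* `VMCells` — the nine valuation-matching sums over SHALLOW cells are bounded by an absolute constant `A₀` (first-order saddle
  precision with cancellation of the member's own saddle error between the paired families);
* `TailCells` — the non-shallow cells carry total window-weighted mass `≤ e` (Hölder–restriction + Rankin, coprimality dropped);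
* `FamilySize` — `#F ≥ c · Ψ(x,y)³/x` (zeroth-order major-arc analysis), whence `NonemptyCells`;
* the bookkeeping stub `stub_keyCellStructure_of_cells : CECells → VMCells → TailCells → NonemptyCells → KeyCellStructure (1/4)`
  chooses `N ≥ max N₁ ((A₀ + 3)/δ)` and `M` large.

Only definitions here (plus nothing to prove); the stubs live in the skeleton / their `--supports` files.
-/

-- `Summit.<Summit>.<Problem>` is the mandated summit-side namespace (CONVENTIONS §2); for the
-- single-conjunct summit `ABC` the two coincide, so the duplicate `ABC.ABC` is deliberate.
set_option linter.dupNamespace false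

noncomputable section

namespace Summit.ABC.ABC.Theorems.TameLocalReceptacle

open Finset

/-! ## Parameters and witnesses -/

/-- The master scale `x = 48 · 2^N · M` (all members of all five families are `≤ x/12`; every variable of the engine lives at a
scale `x/e`, `e ∈ ℕ`). -/
def masterScale (N M : ℕ) : ℝ := 48 * 2 ^ N * M

/-- The friability level `y = ⌊(log x)^K⌋₊` with `K = 100000` (polylog regime; `1 − α(x,y) ≈ 10⁻⁵`). -/
def levelOf (N M : ℕ) : ℕ := ⌊Real.log (masterScale N M) ^ (100000 : ℕ)⌋₊

/-- The shallowness threshold `Y = y⁴` (cells `q^{v+1} ≤ Y` are resolved, the others are tails). -/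
def shallowOf (N M : ℕ) : ℕ := levelOf N M ^ 4

/-- Witness family `FA` (special member `a = 2^N m`). -/
def famFA (N M : ℕ) : Finset (ℕ × ℕ × ℕ) := FAfam N M (levelOf N M)

/-- Witness family `FB` (special member `b`; the swap of `FA`). -/
def famFB (N M : ℕ) : Finset (ℕ × ℕ × ℕ) := FBfam N M (levelOf N M)

/-- Witness family `FC` (special member `c = 2^N m`). -/
def famFC (N M : ℕ) : Finset (ℕ × ℕ × ℕ) := FCfam N M (levelOf N M)

/-- Generic family `G` at the scale `X = 2^N M` (same boxes as `FA`, 2-adic depth `1`). -/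
def famG (N M : ℕ) : Finset (ℕ × ℕ × ℕ) := FAfam 1 (2 ^ (N - 1) * M) (levelOf N M)

/-- Generic family `G'` at the small scale `M` (the exact `2^{1−N}`-dilate of `FA`'s shape). -/
def famG' (N M : ℕ) : Finset (ℕ × ℕ × ℕ) := FAfam 1 M (levelOf N M)

/-! ## The family-level targets -/

/-- **CE CELLS.**  For every depth `N ≥ 1` and every exponent `A`, for all large `M`: in each of the five families, each position,
each odd prime `q ≤ y`, each shallow valuation (`q^{v+1} ≤ Y`, `v ≥ 1`) and any two ADMISSIBLE residue classes, the key intensities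
differ by at most `(log M)^{-A}`. -/
def CECells : Prop :=
  ∀ N : ℕ, 1 ≤ N → ∀ A : ℕ, ∃ M₀ : ℕ, ∀ M : ℕ, M₀ ≤ M →
    ∀ F : Finset (ℕ × ℕ × ℕ),
      (F = famFA N M ∨ F = famFB N M ∨ F = famFC N M ∨ F = famG N M ∨ F = famG' N M) →
      ∀ (P : Pos) (q v r s z r' s' z' : ℕ), q.Prime → q ≠ 2 → q ≤ levelOf N M → 1 ≤ v →
        q ^ (v + 1) ≤ shallowOf N M → P.adm q r s z = true → P.adm q r' s' z' = true →
        |intensity F P q (mkDatum (P.exps v) r s z) - intensity F P q (mkDatum (P.exps v) r' s' z')| ≤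
          1 / Real.log M ^ A

/-- The valuation discrepancy of a pair restricted to SHALLOW cells. -/
def shallowVD (Y : ℕ) (F G : Finset (ℕ × ℕ × ℕ)) (P : Pos) (Q V : ℕ) : ℝ :=
  ∑ q ∈ oddPrimesBelow Q, ∑ v ∈ Icc 1 V,
    if q ^ (v + 1) ≤ Y then keyWeight (P.exps v) q * |cellMass F P q v - cellMass G P q v| else 0

/-- **VM CELLS.**  There is an absolute constant `A₀` such that for every depth `N ≥ 1`, for all large `M`, the nine paired
shallow valuation discrepancies (pairs as in `MatchingFamilies`) are `≤ A₀` for every truncation `(Q, V)`. -/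
def VMCells : Prop :=
  ∃ A₀ : ℝ, ∀ N : ℕ, 1 ≤ N → ∃ M₀ : ℕ, ∀ M : ℕ, M₀ ≤ M → ∀ Q V : ℕ,
    shallowVD (shallowOf N M) (famFA N M) (famG' N M) Pos.A Q V ≤ A₀ ∧
    shallowVD (shallowOf N M) (famFA N M) (famG N M) Pos.B Q V ≤ A₀ ∧
    shallowVD (shallowOf N M) (famFA N M) (famG N M) Pos.C Q V ≤ A₀ ∧
    shallowVD (shallowOf N M) (famFB N M) (famG N M) Pos.A Q V ≤ A₀ ∧
    shallowVD (shallowOf N M) (famFB N M) (famG' N M) Pos.B Q V ≤ A₀ ∧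
    shallowVD (shallowOf N M) (famFB N M) (famG N M) Pos.C Q V ≤ A₀ ∧
    shallowVD (shallowOf N M) (famFC N M) (famG N M) Pos.A Q V ≤ A₀ ∧
    shallowVD (shallowOf N M) (famFC N M) (famG N M) Pos.B Q V ≤ A₀ ∧
    shallowVD (shallowOf N M) (famFC N M) (famG' N M) Pos.C Q V ≤ A₀

/-- **TAIL CELLS.**  For every depth `N ≥ 1` and `e > 0`, for all large `M`, the non-shallow cells of each of the five families
carry window-weighted mass `≤ e` (`TailSmall`). -/
def TailCells : Prop :=
  ∀ N : ℕ, 1 ≤ N → ∀ e : ℝ, 0 < e → ∃ M₀ : ℕ, ∀ M : ℕ, M₀ ≤ M →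
    TailSmall e (shallowOf N M) (famFA N M) ∧ TailSmall e (shallowOf N M) (famFB N M) ∧
    TailSmall e (shallowOf N M) (famFC N M) ∧ TailSmall e (shallowOf N M) (famG N M) ∧
    TailSmall e (shallowOf N M) (famG' N M)

/-- **FAMILY SIZE.**  For every depth `N ≥ 1` there is `c > 0` such that for all large `M` each of the five families has at least
`c · Ψ(x, y)³ / x` members (`x = masterScale N M`, `y = levelOf N M`). -/
def FamilySize : Prop :=
  ∀ N : ℕ, 1 ≤ N → ∃ c : ℝ, 0 < c ∧ ∃ M₀ : ℕ, ∀ M : ℕ, M₀ ≤ M →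
    ∀ F : Finset (ℕ × ℕ × ℕ),
      (F = famFA N M ∨ F = famFB N M ∨ F = famFC N M ∨ F = famG N M ∨ F = famG' N M) →
      c * ((Nat.smoothNumbersUpTo ⌊masterScale N M⌋₊ (levelOf N M + 1)).card : ℝ) ^ 3 / masterScale N M ≤ F.card

/-- **NONEMPTY CELLS.**  For every depth `N ≥ 1`, for all large `M`, the five families are nonempty. -/
def NonemptyCells : Prop :=
  ∀ N : ℕ, 1 ≤ N → ∃ M₀ : ℕ, ∀ M : ℕ, M₀ ≤ M →
    (famFA N M).Nonempty ∧ (famFB N M).Nonempty ∧ (famFC N M).Nonempty ∧ (famG N M).Nonempty ∧ (famG' N M).Nonempty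

/-! ## A registered helper -/

/-- **Registered stub `stub_shallowVD_nonneg`**: shallow valuation discrepancies are nonnegative (every summand is a window
weight `(v+1) log q ≥ 0` times an absolute value, or `0`). [folklore] -/
theorem stub_shallowVD_nonneg : ∀ (Y : ℕ) (F G : Finset (ℕ × ℕ × ℕ)) (P : Pos) (Q V : ℕ), 0 ≤ shallowVD Y F G P Q V := by
  intro Y F G P Q V
  unfold shallowVD
  refine Finset.sum_nonneg fun q _ => Finset.sum_nonneg fun v _ => ?_
  split_ifs
  · refine mul_nonneg (mul_nonneg (by positivity) (Real.log_natCast_nonneg q)) (abs_nonneg _)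
  · exact le_rfl

end Summit.ABC.ABC.Theorems.TameLocalReceptacle

end
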